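import Mathlib
import Summits.Ventures.PercRepro2.HCov
import Summits.Ventures.PercRepro2.HCovCubic
import Summits.Ventures.PercRepro2.TriDisagreement
import Summits.Ventures.PercRepro2.TriDisagreementPinned
import Summits.Ventures.PercRepro2.TypedSplit
import Summits.Ventures.PercRepro2.OneTypedEdge
import Summits.Ventures.PercRepro2.TypedSeries
import Summits.Ventures.PercRepro2.StarPattern
import Summits.Ventures.PercRepro2.StarIdentities
import Summits.Ventures.PercRepro2.StarDebt
import Summits.Ventures.PercRepro2.StarPairsBone

/-!
# The type-2 pair bases of a star are typed counts of the graph itself (blind cell PercRepro2,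
p1 g12; the graph-row reading of the one-rung objects after NEG-108, part I′)

A PAIR block `{s_i, s_j}` of the star at `y` open in a copy is `y` as a series vertex between
`u_i` and `u_j`; pinning `s_j` OPEN (in every copy) and typing `s_i` realises the pair base as a
typed count of the graph `G` itself on the minor `(insert s_i F₀, z₀[s_j ↦ open])`: in the copies
where `s_i` is closed `y` is pendant at `u_j` and invisible (`patCount_close_*`). So

* `B(p₁) = N(G; s_i of type 1, s_j open)` (`StarPairsBone.lean`);
* `B(p₂) = N(G; s_i of type 2, s_j open)` (**`Btype2_01_eq_typedCount`**, …);
* `B(p₁, q₁) = N(G; the two other star edges of type 1, the shared one open)`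
  (**`Btwo_01_02_eq_typedCount`**, `Btwo_01_12_…`, `Btwo_02_12_…`).

Consequently every pair-block object of the debt identities (`star_212`, `star_122`:
`B(01₁,02₁)`, `B(02₂)`, `B(02₁,12₁)`, …) is an instance of the GRAPH row 2′TRI on a minor of `G`
(`G` itself, unmarked vertices allowed); the only one-rung objects that are not are those with
the triple block `T` (`B(T₁)`, `B(T₂)`, `E(T;p) = B(p₁,T₁) − B(T₁)`, `Λ(01;02;12)`). Identities only.
-/

namespace Summit.Ventures.PercRepro2

open CovForm CovForm.OneTyped CovForm.TypedRed

namespace StarPattern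

section Pairs

variable {V : Type*} {E : Type*} [Fintype E] [DecidableEq E] {R : Type*} [Field R]
  {ends : E → Sym2 V} {o a₁ a₂ a₃ b : V} {s₁ s₂ s₃ : E} {y u₁ u₂ u₃ : V} {F₀ : Finset E}
  {z₀ : Config E}

/-- **The type-`2` pair base `B(01₂)` is a typed count of the graph**: `s₂` pinned open,
`s₁` of type `2`. -/
theorem Btype2_01_eq_typedCount (D : StarData ends o a₁ a₂ a₃ b s₁ s₂ s₃ y u₁ u₂ u₃ F₀ z₀)
    (τ : E → ℕ) (hz₁ : z₀ s₁ = false) (hz₂ : z₀ s₂ = false) (hz₃ : z₀ s₃ = false) :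
    typedCount (insert s₁ F₀) (Function.update z₀ s₂ true) (Function.update τ s₁ 2)
        (K3 ends o a₁ a₂ a₃ b : Config E → Config E → Config E → R) =
      Btype2 ends o a₁ a₂ a₃ b s₁ s₂ s₃ F₀ z₀ τ (true, true, false) := by
  rw [typedCount_split (insert s₁ F₀) s₁ (Finset.mem_insert_self _ _)]
  simp only [Function.update_self, Finset.erase_insert D.hF₁, sum_bool3_two]
  rw [pinned_term_21 D τ hz₁ hz₂ hz₃, pinned_term_21 D τ hz₁ hz₂ hz₃,
    pinned_term_21 D τ hz₁ hz₂ hz₃]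
  rw [patCount_close_w D τ _ _ (Or.inr (Or.inl rfl)), patCount_close_y D τ _ (Or.inr (Or.inl rfl)),
    patCount_close_x D τ (Or.inr (Or.inl rfl))]
  unfold Btype2
  ring

/-- **The type-`2` pair base `B(02₂)` is a typed count of the graph**: `s₃` pinned open,
`s₁` of type `2`. -/
theorem Btype2_02_eq_typedCount (D : StarData ends o a₁ a₂ a₃ b s₁ s₂ s₃ y u₁ u₂ u₃ F₀ z₀)
    (τ : E → ℕ) (hz₁ : z₀ s₁ = false) (hz₂ : z₀ s₂ = false) (hz₃ : z₀ s₃ = false) :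
    typedCount (insert s₁ F₀) (Function.update z₀ s₃ true) (Function.update τ s₁ 2)
        (K3 ends o a₁ a₂ a₃ b : Config E → Config E → Config E → R) =
      Btype2 ends o a₁ a₂ a₃ b s₁ s₂ s₃ F₀ z₀ τ (true, false, true) := by
  rw [typedCount_split (insert s₁ F₀) s₁ (Finset.mem_insert_self _ _)]
  simp only [Function.update_self, Finset.erase_insert D.hF₁, sum_bool3_two]
  rw [pinned_term_31 D τ hz₁ hz₂ hz₃, pinned_term_31 D τ hz₁ hz₂ hz₃,
    pinned_term_31 D τ hz₁ hz₂ hz₃]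
  rw [patCount_close_w D τ _ _ (Or.inr (Or.inr rfl)), patCount_close_y D τ _ (Or.inr (Or.inr rfl)),
    patCount_close_x D τ (Or.inr (Or.inr rfl))]
  unfold Btype2
  ring

/-- **The type-`2` pair base `B(12₂)` is a typed count of the graph**: `s₃` pinned open,
`s₂` of type `2`. -/
theorem Btype2_12_eq_typedCount (D : StarData ends o a₁ a₂ a₃ b s₁ s₂ s₃ y u₁ u₂ u₃ F₀ z₀)
    (τ : E → ℕ) (hz₁ : z₀ s₁ = false) (hz₂ : z₀ s₂ = false) (hz₃ : z₀ s₃ = false) :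
    typedCount (insert s₂ F₀) (Function.update z₀ s₃ true) (Function.update τ s₂ 2)
        (K3 ends o a₁ a₂ a₃ b : Config E → Config E → Config E → R) =
      Btype2 ends o a₁ a₂ a₃ b s₁ s₂ s₃ F₀ z₀ τ (false, true, true) := by
  rw [typedCount_split (insert s₂ F₀) s₂ (Finset.mem_insert_self _ _)]
  simp only [Function.update_self, Finset.erase_insert D.hF₂, sum_bool3_two]
  rw [pinned_term_32 D τ hz₁ hz₂ hz₃, pinned_term_32 D τ hz₁ hz₂ hz₃,
    pinned_term_32 D τ hz₁ hz₂ hz₃]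
  rw [patCount_close_w D τ _ _ (Or.inr (Or.inr rfl)), patCount_close_y D τ _ (Or.inr (Or.inr rfl)),
    patCount_close_x D τ (Or.inr (Or.inr rfl))]
  unfold Btype2
  ring

end Pairs

end StarPattern

end Summit.Ventures.PercRepro2
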